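import Summits.ResolutionOfSingularities.ResolutionOfSingularities.Theorems.MarkedTransferCampaignW46ThreefoldsGammaFreeGlobalBranchLocal
import HarnessLib

/-!
# [OURS · L1 W4.6 rung (ii), dimension ladder] THE TERMINATION MEASURE AWAY FROM THE BLOWN-UP POINT: invariance of the local terms
# off the exceptional curve, finiteness of the supports, and the splitting of the sums (brick B10b-away of rung (ii-2))

Cell res-hironaka, LADDER-RESOLUTION rung L (D-0089), slot W4.6, rung (ii) (dimension ladder, res-L1-type-o1 p496755); seat
res-D-pv-049 AS res-L1-s46-pv-11 (holder of rung (ii-2); architecture v2, STATUS 2026-08-27T05:4xZ). Host route MarkedTransfer,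
host item `HypersurfaceOrderReductionDimLeThree` (stmt-ResolutionOfSingularities-16156); proposed `--kind proof --supports` it
`--as helper`. Everything here is OURS bookkeeping; nothing of H. Hironaka's manuscript [Hironaka2017] is asserted. AI-written;
AI review is weaker than expert review.

## What is proved

For the blowing up `π : X′ → X` of a closed point `x` of a regular scheme and families `ζ : ι → X`, `ζ′ : ι ⊕ σ → X′` with
`π (ζ′ (inl k)) = ζ k` and `π (ζ′ (inr s)) = x` (the shape of bricks B10b-fam / B10b-reg):

* `specializes_iff_of_apply_ne` — off the exceptional curve, `ζ′ ⤳ y′ ↔ π ζ′ ⤳ π y′` (`π` is an isomorphism over `X ∖ {x}`);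
  `pairLength_eq_of_apply_ne` — the local intersection numbers there are unchanged;
* `pairTangencyAt_inl_inl_of_apply_ne`, `pairTangencyAt_inr_of_apply_ne`, `branchCount_eq_of_apply_ne` — the local terms of the
  measure at `y′` with `π y′ ≠ x` equal those at `π y′`;
* `finite_setOf_two_branches` — on an integral Noetherian quasi-excellent scheme of dimension `≤ 2` only finitely many points carry
  two distinct branches of a finite family of prime divisors (res-D-pv-039's `finite_badSet_branch`); hence the supports of
  `pairTangencyAt ζ k l` (`k ≠ l`) and of `branchCount ζ − 2` are finite;
* `finsum_eq_finsum_mem_preimage_add`, `finsum_eq_add_finsum_mem_compl` — splitting a finitely supported sum over `X′` into the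
  part over `x` and the part off it (transported to `X ∖ {x}` along `π`), and a sum over `X` into the term at `x` and the rest.

## Sources

* R. Hartshorne, *Algebraic Geometry* (1977), Ch. V Prop. 3.6, Thm. 3.9. [Hartshorne1977]
* The Stacks Project, Tag 02OS (the blowing up is an isomorphism off the centre). [StacksProject]
* H. Hironaka, ms. 2017-03-23, Def. 2.1 p.5 — scope only, under adjudication, not cited as fact. [Hironaka2017]
-/

noncomputable section

set_option linter.dupNamespace false -- mandated namespace of this single-conjunct summit

open CategoryTheory AlgebraicGeometry TopologicalSpace IsLocalRing Topology

namespace Summit.ResolutionOfSingularities.ResolutionOfSingularities.Theorems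

namespace CampaignW46

open Literature.AlgebraicGeometry.Resolution
open Scheme.IdealSheafData

universe u

/-! ## §1 Off the exceptional curve nothing changes -/

section Away

variable {X X' : Scheme.{u}} {x : X} (hx : IsClosed ({x} : Set X)) {π : X' ⟶ X}
  (hπ : IsBlowup π (vanishingIdeal ⟨{x}, hx⟩))

include hπ in
/-- **Specialisation off the exceptional curve**: for `π y′ ≠ x`, `ζ′ ⤳ y′ ↔ π ζ′ ⤳ π y′` (`π` restricts to an isomorphism
`π⁻¹(X ∖ {x}) ≅ X ∖ {x}`, and specialisation is computed inside these opens). [cite: StacksProject, Tag 02OS] -/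
theorem specializes_iff_of_apply_ne {ζ' y' : X'} (hy : π y' ≠ x) : ζ' ⤳ y' ↔ π ζ' ⤳ π y' := by
  refine ⟨fun h => h.map π.continuous, fun h => ?_⟩
  have hζ : π ζ' ≠ x := fun e => hy ((h.mem_closed hx (by rw [e]; rfl)).symm ▸ rfl)
  set W : X.Opens := ⟨((vanishingIdeal (⟨{x}, hx⟩ : Closeds X)).support : Set X)ᶜ,
    (vanishingIdeal (⟨{x}, hx⟩ : Closeds X)).support.isClosed.isOpen_compl⟩ with hW
  haveI : IsIso (π ∣_ W) := hπ.isIso_compl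
  have hmem : ∀ {z : X'}, π z ≠ x → z ∈ π ⁻¹ᵁ W := fun {z} hz => by
    change π z ∈ ((vanishingIdeal (⟨{x}, hx⟩ : Closeds X)).support : Set X)ᶜ
    rw [coe_support_vanishingIdeal]; exact hz
  haveI hg : IsOpenImmersion ((π ⁻¹ᵁ W).ι ≫ π) := by rw [← morphismRestrict_ι]; infer_instance
  have key : ((π ⁻¹ᵁ W).ι ≫ π) ⟨ζ', hmem hζ⟩ ⤳ ((π ⁻¹ᵁ W).ι ≫ π) ⟨y', hmem hy⟩ := by
    rw [Scheme.Hom.comp_apply, Scheme.Hom.comp_apply, Scheme.Opens.ι_apply, Scheme.Opens.ι_apply]; exact h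
  have h2 := ((π ⁻¹ᵁ W).ι ≫ π).isOpenEmbedding.isInducing.specializes_iff.mp key
  have h3 := (π ⁻¹ᵁ W).ι.isOpenEmbedding.isInducing.specializes_iff.mpr h2
  rw [Scheme.Opens.ι_apply, Scheme.Opens.ι_apply] at h3
  exact h3

include hπ in
/-- Off the exceptional curve `ζ′ = y′ ↔ π ζ′ = π y′`. [cite: StacksProject, Tag 02OS] -/
theorem eq_iff_of_apply_ne {ζ' y' : X'} (hy : π y' ≠ x) : ζ' = y' ↔ π ζ' = π y' :=
  ⟨fun h => by rw [h], fun h => eq_of_apply_eq_of_ne_centre hx hπ (by rw [h]; exact hy) h⟩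

include hπ in
/-- **Local intersection numbers off the exceptional curve are unchanged**: for `π y′ ≠ x` and `ζ′₁, ζ′₂ ⤳ y′`,
`i_{y′}(cl ζ′₁, cl ζ′₂) = i_{π y′}(cl π ζ′₁, cl π ζ′₂)` (`π♯_{y′}` is an isomorphism carrying `𝔭_{π ζ′}` to `𝔭_{ζ′}`).
[cite: StacksProject, Tag 02OS] -/
theorem pairLength_eq_of_apply_ne {ζ₁ ζ₂ y' : X'} (hy : π y' ≠ x) (h₁ : ζ₁ ⤳ y') (h₂ : ζ₂ ⤳ y') :
    pairLength ζ₁ ζ₂ y' = pairLength (π ζ₁) (π ζ₂) (π y') := by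
  haveI : IsIso (π.stalkMap y') := hπ.isIso_stalkMap_of_not_mem_support (apply_not_mem_support_of_apply_ne hx hy)
  set ε := (π.stalkMap y').hom with hε
  have hbij : Function.Bijective ε := (asIso (π.stalkMap y')).commRingCatIsoToRingEquiv.bijective
  have hker : RingHom.ker ε = ⊥ := (RingHom.injective_iff_ker_eq_bot ε).mp hbij.1
  rw [pairLength_def, pairLength_def, ← comap_stalkMap_stalkIdeal_primeDivisorIdeal π h₁,
    ← comap_stalkMap_stalkIdeal_primeDivisorIdeal π h₂, ← hε]
  have h := length_quotient_sup_eq_of_surjective ε hbij.2 hker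
    ((stalkIdeal (primeDivisorIdeal ζ₁) y').comap ε ⊔ (stalkIdeal (primeDivisorIdeal ζ₂) y').comap ε)
  rw [bot_sup_eq, Ideal.map_sup, Ideal.map_comap_of_surjective ε hbij.2, Ideal.map_comap_of_surjective ε hbij.2] at h
  exact h.symm

variable {ι σ : Type} (ζ : ι → X) (ζ' : ι ⊕ σ → X') (hinl : ∀ k, π (ζ' (Sum.inl k)) = ζ k)
  (hinr : ∀ s, π (ζ' (Sum.inr s)) = x)

include hπ hinl in
/-- Off the exceptional curve the branch `inl k` of the new family passes through `y′` iff the branch `k` passes through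
`π y′`. [cite: StacksProject, Tag 02OS] -/
theorem through_inl_iff_of_apply_ne {y' : X'} (hy : π y' ≠ x) (k : ι) :
    (ζ' (Sum.inl k) ⤳ y' ∧ ζ' (Sum.inl k) ≠ y') ↔ (ζ k ⤳ π y' ∧ ζ k ≠ π y') := by
  rw [specializes_iff_of_apply_ne hx hπ hy, Ne, eq_iff_of_apply_ne hx hπ hy, hinl]

include hx hinr in
/-- Off the exceptional curve no branch `inr s` passes through `y′`. [folklore] -/
theorem not_through_inr_of_apply_ne {y' : X'} (hy : π y' ≠ x) (s : σ) : ¬ (ζ' (Sum.inr s) ⤳ y') := fun h =>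
  hy ((h.map π.continuous).mem_closed hx (by rw [hinr]; rfl))

include hπ hinl in
/-- **The tangency term of a pair of old branches is unchanged off the exceptional curve.** [cite: Hartshorne1977, Ch. V Prop. 3.6] -/
theorem pairTangencyAt_inl_inl_of_apply_ne {y' : X'} (hy : π y' ≠ x) (k l : ι) :
    pairTangencyAt ζ' (Sum.inl k) (Sum.inl l) y' = pairTangencyAt ζ k l (π y') := by
  by_cases h : ζ' (Sum.inl k) ⤳ y' ∧ ζ' (Sum.inl k) ≠ y' ∧ ζ' (Sum.inl l) ⤳ y' ∧ ζ' (Sum.inl l) ≠ y'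
  · have hk := (through_inl_iff_of_apply_ne hx hπ ζ ζ' hinl hy k).mp ⟨h.1, h.2.1⟩
    have hl := (through_inl_iff_of_apply_ne hx hπ ζ ζ' hinl hy l).mp ⟨h.2.2.1, h.2.2.2⟩
    rw [pairTangencyAt_of_through h, pairTangencyAt_of_through ⟨hk.1, hk.2, hl.1, hl.2⟩,
      pairLength_eq_of_apply_ne hx hπ hy h.1 h.2.2.1, hinl, hinl]
  · rw [pairTangencyAt_of_not_through h, pairTangencyAt_of_not_through]
    rintro ⟨hk1, hk2, hl1, hl2⟩
    exact h ⟨((through_inl_iff_of_apply_ne hx hπ ζ ζ' hinl hy k).mpr ⟨hk1, hk2⟩).1,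
      ((through_inl_iff_of_apply_ne hx hπ ζ ζ' hinl hy k).mpr ⟨hk1, hk2⟩).2,
      ((through_inl_iff_of_apply_ne hx hπ ζ ζ' hinl hy l).mpr ⟨hl1, hl2⟩).1,
      ((through_inl_iff_of_apply_ne hx hπ ζ ζ' hinl hy l).mpr ⟨hl1, hl2⟩).2⟩

include hx hinr in
/-- A tangency term involving the exceptional branch vanishes off the exceptional curve. [folklore] -/
theorem pairTangencyAt_inr_of_apply_ne {y' : X'} (hy : π y' ≠ x) (k' : ι ⊕ σ) (s : σ) :
    pairTangencyAt ζ' k' (Sum.inr s) y' = 0 ∧ pairTangencyAt ζ' (Sum.inr s) k' y' = 0 := by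
  have h := not_through_inr_of_apply_ne hx ζ' hinr hy s
  exact ⟨pairTangencyAt_of_not_through fun h' => h h'.2.2.1, pairTangencyAt_of_not_through fun h' => h h'.1⟩

include hπ hinl hinr in
/-- **The number of branches through a point off the exceptional curve is unchanged.** [folklore] -/
theorem branchCount_eq_of_apply_ne [Finite ι] [Finite σ] {y' : X'} (hy : π y' ≠ x) :
    branchCount ζ' y' = branchCount ζ (π y') := by
  rw [branchCount_def, branchCount_def]
  -- the two injections
  have hex : ∀ b : {k' : ι ⊕ σ // ζ' k' ⤳ y' ∧ ζ' k' ≠ y'}, ∃ k, b.1 = Sum.inl k ∧ (ζ k ⤳ π y' ∧ ζ k ≠ π y') := by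
    rintro ⟨k' | s, h⟩
    · exact ⟨k', rfl, (through_inl_iff_of_apply_ne hx hπ ζ ζ' hinl hy k').mp h⟩
    · exact absurd h.1 (not_through_inr_of_apply_ne hx ζ' hinr hy s)
  apply le_antisymm
  · refine Nat.card_le_card_of_injective (fun b => ⟨(hex b).choose, (hex b).choose_spec.2⟩) fun b₁ b₂ h => ?_
    have h' := congrArg Subtype.val h
    simp only at h'
    exact Subtype.ext ((hex b₁).choose_spec.1.trans (h' ▸ (hex b₂).choose_spec.1.symm))
  · refine Nat.card_le_card_of_injective
      (fun b => ⟨Sum.inl b.1, (through_inl_iff_of_apply_ne hx hπ ζ ζ' hinl hy b.1).mpr b.2⟩) fun b₁ b₂ h => ?_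
    have h' := congrArg Subtype.val h
    simp only [Sum.inl.injEq] at h'
    exact Subtype.ext h'

end Away

/-! ## §2 Finiteness of the supports -/

section Finite

variable {X : Scheme.{u}} [IsIntegral X] [IsNoetherian X] {ι : Type} [Finite ι]

/-- **Only finitely many points carry two distinct branches** (of a finite injective family of codimension-one points on an
integral Noetherian quasi-excellent scheme of dimension `≤ 2`). [cite: Kollar2007, (3.111) Step 3] -/
theorem finite_setOf_two_branches (hXe : Scheme.IsQuasiExcellent X) (hdim : topologicalKrullDim X ≤ 2) (ζ : ι → X)
    (hζ : Function.Injective ζ) (hcoh : ∀ k, Order.coheight (ζ k) = 1) :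
    {y : X | ∃ k l, k ≠ l ∧ ζ k ⤳ y ∧ ζ l ⤳ y}.Finite := by
  have hS : (Set.range ζ).Finite := Set.finite_range ζ
  have hS1 : ∀ ζ₀ ∈ Set.range ζ, Order.coheight ζ₀ = 1 := by rintro _ ⟨k, rfl⟩; exact hcoh k
  refine (hS.biUnion fun ζ₀ hζ₀ => (finite_badSet_branch hXe hdim (hS1 ζ₀ hζ₀) hS hS1).1).subset ?_
  rintro y ⟨k, l, hkl, hk, hl⟩
  exact Set.mem_biUnion ⟨k, rfl⟩ ⟨hk, Or.inr ⟨ζ l, ⟨l, rfl⟩, fun e => hkl (hζ e).symm, hl⟩⟩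

/-- The support of the tangency term of a pair of distinct branches is finite. [folklore] -/
theorem finite_support_pairTangencyAt (hXe : Scheme.IsQuasiExcellent X) (hdim : topologicalKrullDim X ≤ 2) (ζ : ι → X)
    (hζ : Function.Injective ζ) (hcoh : ∀ k, Order.coheight (ζ k) = 1) {k l : ι} (hkl : k ≠ l) :
    (Function.support (pairTangencyAt ζ k l)).Finite := by
  refine (finite_setOf_two_branches hXe hdim ζ hζ hcoh).subset fun y hy => ?_
  by_contra hn
  exact hy (pairTangencyAt_of_not_through fun h => hn ⟨k, l, hkl, h.1, h.2.2.1⟩)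

/-- The support of the excess term `branchCount − 2` is finite. [folklore] -/
theorem finite_support_branchCount_sub_two (hXe : Scheme.IsQuasiExcellent X) (hdim : topologicalKrullDim X ≤ 2) (ζ : ι → X)
    (hζ : Function.Injective ζ) (hcoh : ∀ k, Order.coheight (ζ k) = 1) :
    (Function.support fun y => branchCount ζ y - 2).Finite := by
  refine (finite_setOf_two_branches hXe hdim ζ hζ hcoh).subset fun y hy => ?_
  rw [Function.mem_support] at hy
  have h2 : 1 < Nat.card {k : ι // ζ k ⤳ y ∧ ζ k ≠ y} := by rw [← branchCount_def]; omega
  obtain ⟨⟨b₁, hb₁⟩, ⟨b₂, hb₂⟩, hne⟩ := nontrivial_iff.mp (Finite.one_lt_card_iff_nontrivial.mp h2)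
  exact ⟨b₁, b₂, fun e => hne (Subtype.ext e), hb₁.1, hb₂.1⟩

end Finite

/-! ## §3 Splitting the sums -/

section Split

variable {X X' : Scheme.{u}} {x : X} (hx : IsClosed ({x} : Set X)) {π : X' ⟶ X}
  (hπ : IsBlowup π (vanishingIdeal ⟨{x}, hx⟩)) {M : Type*} [AddCommMonoid M]

include hπ in
/-- **Splitting a finitely supported sum over `X′`** into the part over `x` and the part off it, the latter transported to
`X ∖ {x}` along the bijection `π`. [cite: StacksProject, Tag 02OS] -/
theorem finsum_eq_finsum_mem_preimage_add {f' : X' → M} {f : X → M} (hfin' : (Function.support f').Finite)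
    (heq : ∀ y', π y' ≠ x → f' y' = f (π y')) :
    ∑ᶠ y', f' y' = (∑ᶠ y' ∈ π ⁻¹' ({x} : Set X), f' y') + ∑ᶠ y ∈ ({x} : Set X)ᶜ, f y := by
  have hunion : (π ⁻¹' ({x} : Set X)) ∪ (π ⁻¹' ({x} : Set X))ᶜ = Set.univ := Set.union_compl_self _
  rw [← finsum_mem_univ, ← hunion, finsum_mem_union' disjoint_compl_right (hfin'.subset Set.inter_subset_right)
    (hfin'.subset Set.inter_subset_right)]
  congr 1
  refine finsum_mem_eq_of_bijOn π ⟨fun y' hy' => hy', ?_, ?_⟩ fun y' hy' => heq y' hy'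
  · intro y₁ h₁ y₂ _ h
    exact eq_of_apply_eq_of_ne_centre hx hπ h₁ h
  · intro y hy
    obtain ⟨y', hy'⟩ := exists_eq_of_ne_centre hx hπ (ζ := y) hy
    exact ⟨y', by rw [Set.mem_compl_iff, Set.mem_preimage, hy']; exact hy, hy'⟩

omit hx in
/-- Splitting a finitely supported sum over `X` into the term at `x` and the rest. [folklore] -/
theorem finsum_eq_add_finsum_mem_compl {f : X → M} (hfin : (Function.support f).Finite) (x : X) :
    ∑ᶠ y, f y = f x + ∑ᶠ y ∈ ({x} : Set X)ᶜ, f y := by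
  have h : insert x (({x} : Set X)ᶜ) = Set.univ := by
    ext y; by_cases hy : y = x <;> simp [hy]
  rw [← finsum_mem_univ, ← h, finsum_mem_insert' f (by simp) (hfin.subset Set.inter_subset_right)]

/-- A sum over a set on which only one point can contribute. [folklore] -/
theorem finsum_mem_eq_of_forall_ne_eq_zero {Y : Type*} {f : Y → M} {s : Set Y} {a : Y} (ha : a ∈ s)
    (h : ∀ y ∈ s, y ≠ a → f y = 0) : ∑ᶠ y ∈ s, f y = f a := by
  classical
  rw [finsum_mem_def]
  rw [finsum_eq_single _ a fun y hy => ?_]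
  · exact Set.indicator_of_mem ha f
  · by_cases hys : y ∈ s
    · rw [Set.indicator_of_mem hys, h y hys hy]
    · exact Set.indicator_of_notMem hys f

/-- A `finsum` over a finite sum type splits. [folklore] -/
theorem finsum_sum_type {α β : Type} [Finite α] [Finite β] (f : α ⊕ β → M) :
    ∑ᶠ c, f c = (∑ᶠ a, f (Sum.inl a)) + ∑ᶠ b, f (Sum.inr b) := by
  classical
  haveI := Fintype.ofFinite α
  haveI := Fintype.ofFinite β
  rw [finsum_eq_sum_of_fintype, finsum_eq_sum_of_fintype, finsum_eq_sum_of_fintype, Fintype.sum_sum_type]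

end Split

end CampaignW46

end Summit.ResolutionOfSingularities.ResolutionOfSingularities.Theorems

end
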